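import Summits.CriticalPhenomena.Ising3D.TaylorTableHeads
import Mathlib.Data.List.Nodup
import Mathlib.Tactic.Linarith
import HarnessLib

/-!
# The TABLE layer of a derivative certificate, XXXI: canonical head lists as a FUNCTION and the structural cell checks without `decide`
(cell `pub-ising3x`, seat boot-1 gen 10; gate (g2) — the `TaylorTable`-instance side of a γ-box certificate: `checkS` for hundreds of cells)

HONEST FRAMING: lottery ticket; floor = tightest certified 3D Ising CFT bounds; no exact-solution
claim without a proof. Island framing: certified exclusion region at stated derivative order and
assumptions; not a determination of the 3D Ising critical exponents beyond that.

A real γ-box table (Λ = 11, `E₀ = E_T = 40`) has ≈ 800 head cells whose head lists hold up to ≈ 400 index pairs each; the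
structural per-cell check `checkEvenCellS` / `checkOddCellS` (duplicate-free head list, descendant range, `ℓ ≤ lo`, and the
canonical-head-set test `canonOK`, quadratic in the list) costs ≈ 20 s of kernel time per low cell by `decide` (boot-1 g9,
HEAD-DELTA.md §7.10) — hours per table. This file removes that cost: the canonical head list is the FUNCTION
`canonF ℓ lo E` (levels `n` with `n < E − lo` ascending, and for each level the descendant indices `j ≤ ℓ + n` with
`InDescendantRange ℓ n j`, ascending — literally the list the twins `fasthead.canon_F` / `layout.canon_F` produce), and the four
conjuncts of the structural check are THEOREMS about it: `canonF_nodup`, `snd_le_of_mem_canonF`, `canonOK_canonF_append`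
(`canonOK` is monotone in the list, `canonOK_of_forall`). A table whose cells are generated from a LAYOUT list
`(ℓ, lo, hi, extra)` by `mkEvenCell E` / `mkOddCell E` (head list `canonF ℓ lo E ++ extra`, no enclosure data, trivial kd-trees —
the δ-expanded head certificates need neither) passes `T.evenCells.all T.checkEvenCellS` / `T.oddCells.all T.checkOddCellS` as soon
as the cheap Boolean `cellSideOK E` holds for every layout entry (`ℓ ≤ lo`; the `extra` terms duplicate-free, in range, and not
already canonical): `evenCellsS_of_layout`, `oddCellsS_of_layout`. The `extra` slot serves the top spin's threshold cell, whose
canonical list is the single level-0 term (boot-1 g9, HEAD-DELTA.md §7.6). Sources: Kos–Poland–Simmons-Duffin 2014 §3.3 (head/tail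
split of the block expansion); elementary list bookkeeping. [folklore]
-/

namespace Summit.CriticalPhenomena.Ising3D

open Literature.MathematicalPhysics.QuantumFieldTheory.ConformalBootstrap3D
open Literature.Analysis.ValidatedNumerics

/-! ### The canonical head list as a function -/

/-- The descendant indices of spin `ℓ` at level `n`, ascending: `j ≤ ℓ + n` with `InDescendantRange ℓ n j`, as pairs `(n, j)`.
[folklore] -/
def canonRow (ℓ n : ℕ) : List (ℕ × ℕ) :=
  ((List.range (ℓ + n + 1)).filter fun j => decide (InDescendantRange ℓ n j)).map fun j => (n, j)

/-- The levels of a head cell starting at `lo` with threshold `E`: `n < E − lo`, ascending. [folklore] -/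
def canonLevels (lo E : ℚ) : List ℕ :=
  (List.range ⌈E - lo⌉₊).filter fun n => decide ((n : ℚ) < E - lo)

/-- **The canonical head list** of spin `ℓ`, cell left end `lo`, threshold `E`: all descendant index pairs `(n, j)` with
`n < E − lo`, levels ascending, `j` ascending within a level (= the twins' `canon_F`). [folklore] -/
def canonF (ℓ : ℕ) (lo E : ℚ) : List (ℕ × ℕ) :=
  (canonLevels lo E).flatMap (canonRow ℓ)

/-- Membership in a row. [folklore] -/
theorem mem_canonRow {ℓ n : ℕ} {q : ℕ × ℕ} : q ∈ canonRow ℓ n ↔ q.1 = n ∧ InDescendantRange ℓ n q.2 := by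
  constructor
  · intro h
    simp only [canonRow, List.mem_map, List.mem_filter, List.mem_range, decide_eq_true_eq] at h
    obtain ⟨j, ⟨_, hj⟩, rfl⟩ := h
    exact ⟨rfl, hj⟩
  · rintro ⟨h1, h2⟩
    simp only [canonRow, List.mem_map, List.mem_filter, List.mem_range, decide_eq_true_eq]
    refine ⟨q.2, ⟨?_, h2⟩, ?_⟩
    · exact Nat.lt_succ_of_le h2.2.1
    · rw [← h1]

/-- Membership in the level list. [folklore] -/
theorem mem_canonLevels {lo E : ℚ} {n : ℕ} : n ∈ canonLevels lo E ↔ (n : ℚ) < E - lo := by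
  simp only [canonLevels, List.mem_filter, List.mem_range, decide_eq_true_eq, and_iff_right_iff_imp]
  intro h
  by_contra hc
  have hc' : ⌈E - lo⌉₊ ≤ n := not_lt.mp hc
  have : E - lo ≤ (n : ℚ) := (Nat.le_ceil _).trans (by exact_mod_cast hc')
  linarith

/-- **Membership in the canonical head list.** [folklore] -/
theorem mem_canonF {ℓ : ℕ} {lo E : ℚ} {q : ℕ × ℕ} :
    q ∈ canonF ℓ lo E ↔ InDescendantRange ℓ q.1 q.2 ∧ (q.1 : ℚ) < E - lo := by
  simp only [canonF, List.mem_flatMap, mem_canonLevels, mem_canonRow]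
  constructor
  · rintro ⟨n, hn, rfl, hq⟩
    exact ⟨hq, hn⟩
  · rintro ⟨hq, hn⟩
    exact ⟨q.1, hn, rfl, hq⟩

/-- Rows are duplicate-free. [folklore] -/
theorem canonRow_nodup (ℓ n : ℕ) : (canonRow ℓ n).Nodup :=
  (List.nodup_range.filter _).map fun _ _ h => (Prod.mk.injEq _ _ _ _ ▸ h).2

/-- **The canonical head list is duplicate-free.** [folklore] -/
theorem canonF_nodup (ℓ : ℕ) (lo E : ℚ) : (canonF ℓ lo E).Nodup := by
  refine List.nodup_flatMap.2 ⟨fun n _ => canonRow_nodup ℓ n, ?_⟩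
  have hl : (canonLevels lo E).Nodup := List.nodup_range.filter _
  refine hl.imp ?_
  intro a b hab q hqa hqb
  rw [mem_canonRow] at hqa hqb
  exact hab (hqa.1.symm.trans hqb.1)

/-- Every canonical head term is in the descendant range: `j ≤ ℓ + n`. [folklore] -/
theorem snd_le_of_mem_canonF {ℓ : ℕ} {lo E : ℚ} {q : ℕ × ℕ} (h : q ∈ canonF ℓ lo E) : q.2 ≤ ℓ + q.1 :=
  (mem_canonF.mp h).1.2.1

/-- **`canonOK` from a covering property**: if every descendant pair `(n, j)` with `n < E − lo` is listed, the canonical-head-set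
test passes (the test only asks for `⊇`). [folklore] -/
theorem canonOK_of_forall {ℓ : ℕ} {lo E : ℚ} {F : List (ℕ × ℕ)}
    (h : ∀ n j, InDescendantRange ℓ n j → (n : ℚ) < E - lo → (n, j) ∈ F) : canonOK ℓ lo E F = true := by
  simp only [canonOK, List.all_eq_true, List.mem_range, Bool.or_eq_true, Bool.not_eq_true', decide_eq_false_iff_not,
    decide_eq_true_eq]
  intro n _ j _
  by_cases h1 : InDescendantRange ℓ n j
  · by_cases h2 : (n : ℚ) < E - lo
    · exact Or.inr (h n j h1 h2)
    · exact Or.inl (Or.inr h2)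
  · exact Or.inl (Or.inl h1)

/-- **The canonical head list, extended by any extra terms, passes `canonOK`.** [folklore] -/
theorem canonOK_canonF_append (ℓ : ℕ) (lo E : ℚ) (extra : List (ℕ × ℕ)) :
    canonOK ℓ lo E (canonF ℓ lo E ++ extra) = true :=
  canonOK_of_forall fun _ _ h1 h2 => List.mem_append.mpr (Or.inl (mem_canonF.mpr ⟨h1, h2⟩))

/-! ### Cells generated from a layout -/

/-- The cheap side conditions of a layout entry `(ℓ, lo, hi, extra)`: `ℓ ≤ lo`; the extra head terms are duplicate-free, in the
descendant range `j ≤ ℓ + n`, and not already canonical. [folklore] -/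
def cellSideOK (E : ℚ) (x : ℕ × ℚ × ℚ × List (ℕ × ℕ)) : Bool :=
  decide ((x.1 : ℚ) ≤ x.2.1) && decide x.2.2.2.Nodup &&
    x.2.2.2.all fun q => decide (q.2 ≤ x.1 + q.1) && decide (q ∉ canonF x.1 x.2.1 E)

/-- The even table cell of a layout entry: head list `canonF ℓ lo E ++ extra`, no enclosure data, trivial kd-trees (unused by the
δ-expanded head certificates). [folklore] -/
def mkEvenCell (E : ℚ) (x : ℕ × ℚ × ℚ × List (ℕ × ℕ)) : EvenCellData :=
  ⟨x.1, x.2.1, x.2.2.1, canonF x.1 x.2.1 E ++ x.2.2.2, [], .leaf 0, .leaf 0, .leaf 0⟩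

/-- The odd table cell of a layout entry (as `mkEvenCell`). [folklore] -/
def mkOddCell (E : ℚ) (x : ℕ × ℚ × ℚ × List (ℕ × ℕ)) : OddCellData :=
  ⟨x.1, x.2.1, x.2.2.1, canonF x.1 x.2.1 E ++ x.2.2.2, [], .leaf 0⟩

/-- What the side conditions give for the generated head list. [folklore] -/
theorem headList_props {E : ℚ} {x : ℕ × ℚ × ℚ × List (ℕ × ℕ)} (h : cellSideOK E x = true) :
    (canonF x.1 x.2.1 E ++ x.2.2.2).Nodup ∧ (∀ q ∈ canonF x.1 x.2.1 E ++ x.2.2.2, q.2 ≤ x.1 + q.1) ∧ (x.1 : ℚ) ≤ x.2.1 := by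
  simp only [cellSideOK, Bool.and_eq_true, decide_eq_true_eq, List.all_eq_true] at h
  obtain ⟨⟨hle, hnd⟩, hall⟩ := h
  refine ⟨(canonF_nodup _ _ _).append hnd ?_, ?_, hle⟩
  · intro q hq hq'
    exact (hall q hq').2 hq
  · intro q hq
    rcases List.mem_append.mp hq with hq | hq
    · exact snd_le_of_mem_canonF hq
    · exact (hall q hq).1

namespace TaylorTable

variable (T : TaylorTable)

/-- **Structural even-cell check of a generated cell** from its side conditions (no kernel evaluation of the head list). [folklore] -/
theorem checkEvenCellS_mkEvenCell {x : ℕ × ℚ × ℚ × List (ℕ × ℕ)} (h : cellSideOK T.E₀ x = true) :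
    T.checkEvenCellS (mkEvenCell T.E₀ x) = true := by
  obtain ⟨hnd, hrange, hle⟩ := headList_props h
  simp only [checkEvenCellS, mkEvenCell, Bool.and_eq_true, decide_eq_true_eq, List.all_eq_true]
  exact ⟨⟨⟨hnd, hrange⟩, hle⟩, canonOK_canonF_append _ _ _ _⟩

/-- **Structural odd-cell check of a generated cell.** [folklore] -/
theorem checkOddCellS_mkOddCell {x : ℕ × ℚ × ℚ × List (ℕ × ℕ)} (h : cellSideOK T.E_T x = true) :
    T.checkOddCellS (mkOddCell T.E_T x) = true := by
  obtain ⟨hnd, hrange, hle⟩ := headList_props h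
  simp only [checkOddCellS, mkOddCell, Bool.and_eq_true, decide_eq_true_eq, List.all_eq_true]
  exact ⟨⟨⟨hnd, hrange⟩, hle⟩, canonOK_canonF_append _ _ _ _⟩

/-- **All even cells of a layout-generated table pass the structural check** once every layout entry passes `cellSideOK`.
[folklore] -/
theorem evenCellsS_of_layout (lay : List (ℕ × ℚ × ℚ × List (ℕ × ℕ))) (hT : T.evenCells = lay.map (mkEvenCell T.E₀))
    (h : lay.all (cellSideOK T.E₀) = true) : T.evenCells.all T.checkEvenCellS = true := by
  rw [hT, List.all_eq_true]
  rw [List.all_eq_true] at h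
  intro C hC
  obtain ⟨x, hx, rfl⟩ := List.mem_map.mp hC
  exact T.checkEvenCellS_mkEvenCell (h x hx)

/-- **All odd cells of a layout-generated table pass the structural check** once every layout entry passes `cellSideOK`.
[folklore] -/
theorem oddCellsS_of_layout (lay : List (ℕ × ℚ × ℚ × List (ℕ × ℕ))) (hT : T.oddCells = lay.map (mkOddCell T.E_T))
    (h : lay.all (cellSideOK T.E_T) = true) : T.oddCells.all T.checkOddCellS = true := by
  rw [hT, List.all_eq_true]
  rw [List.all_eq_true] at h
  intro C hC
  obtain ⟨x, hx, rfl⟩ := List.mem_map.mp hC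
  exact T.checkOddCellS_mkOddCell (h x hx)

/-- **`checkS` assembled from its six conjuncts** (the form in which a real table proves it: basic checks and covers by `decide`,
the identity conjunct from its kd-certificate file, the per-cell structure from the layout). [folklore] -/
theorem checkS_of_conjuncts (hB : T.checkBasic = true) (hI : T.checkIdentity = true)
    (hE : T.evenCells.all T.checkEvenCellS = true) (hEc : T.checkEvenCover = true)
    (hO : T.oddCells.all T.checkOddCellS = true) (hOc : T.checkOddCover = true) : T.checkS = true := by
  simp only [checkS, Bool.and_eq_true]
  exact ⟨⟨⟨⟨⟨hB, hI⟩, hE⟩, hEc⟩, hO⟩, hOc⟩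

end TaylorTable

/-! ### Sanity examples (tiny, by `decide`) -/

/-- The canonical list of the top even cell `[39, 40]` at spin 38 is the single level-0 term. [folklore] -/
example : canonF 38 39 40 = [(0, 38)] := by decide +kernel

/-- A small canonical list (spin 2, `lo = 37`): levels 0, 1, 2. [folklore] -/
example : canonF 2 37 40 = [(0, 2), (1, 1), (1, 3), (2, 0), (2, 2), (2, 4)] := by decide +kernel

end Summit.CriticalPhenomena.Ising3D
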